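import Summits.CriticalPhenomena.PercolationContinuityZ3.Theorems.PercNearOneGluingNoHeavyLowerTailFrontierDecRowsRow15ThreeOneCutA
import Summits.CriticalPhenomena.PercolationContinuityZ3.Theorems.PercNearOneGluingNoHeavyLowerTailFrontierDecRowsRow15ThreeOneCutY
import Summits.CriticalPhenomena.PercolationContinuityZ3.Theorems.PercNearOneGluingNoHeavyLowerTailFrontierDecRowsRow15ThreeOneCutB
import Summits.CriticalPhenomena.PercolationContinuityZ3.Theorems.PercNearOneGluingNoHeavyLowerTailFrontierDecRowsRow15ThreeOneCutC
import Summits.CriticalPhenomena.PercolationContinuityZ3.Theorems.PercNearOneGluingNoHeavyLowerTailFrontierDecRowsSideRestriction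
import HarnessLib

/-!
# Frontier dec row 15 reduces to cut-free weighted graphs, given its three `2|2` cut cases

Support file for crux `stmt-CriticalPhenomena-4575` (four-point decreasing `E₃` frontier), seat `prim-l12-p6` gen 16; memo
`run/shared/lean/prim/prim-l12/FROM-prim-l12-p6-g16-ROW37-HUB-IDENTITY.md` §4.  No definitions, no named facts, no sorries.
Row 15 is `E₃(D[ab|c], D[ac|y], D[b|y]) ≥ 0` (trivial stabiliser).  All four `3|1` cuts are kernel theorems
(`sahiE3_row15_nonneg_of_threeOneCut_a/_y` gen 15, `_b/_c` gen 16).  The three `2|2` cuts `{a,b}|{c,y}`, `{a,c}|{b,y}`, `{a,y}|{b,c}`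
have exact rational certificates over Harris + 3PT-LB on the two three-point sides (kit j144580, independently re-verified; event-sparse
forms with 8 / 5 / 7 bracket groups, kit j150372) but are NOT yet replayed in Lean, so they enter as the hypotheses `H22ab`, `H22ac`, `H22ay`
(each: "row 15 holds at `(a,b,c,y)` whenever a cut vertex `h` separates the named pair, coloured `true`, from the other two terminals").
THEOREM (`frontier_15_all_of_noCut`): under these three hypotheses, if row 15 holds for every weight admitting NO cut colouring, it holds on
every finite weighted graph (induction on the number of positive edges, word for word as `frontier_36_all_of_noCut` / `frontier_44_all_of_noCut`).
-/

noncomputable section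

namespace Summit.CriticalPhenomena.PercolationContinuityZ3.Theorems.FrontierDecRows

open MeasureTheory CovTransferCert E3GroupSepCert
open Literature.Probability.Percolation Literature.Probability.LatticeModels

variable {n : ℕ}

/-- **Row 15 reduces to cut-free weighted graphs, given the three `2|2` cut cases.** [this work] -/
theorem frontier_15_all_of_noCut
    (H22ab : ∀ (n : ℕ) (w : Sym2 (Fin n) → unitInterval) (a b c y h : Fin n) (side : Fin n → Bool),
      side a = true → side b = true → side c = false → side y = false →
      (∀ u v : Fin n, u ≠ h → v ≠ h → side u ≠ side v → w s(u, v) = 0) →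
      0 ≤ sahiE3 (prodBernoulli w) (connEvent (row 15 n (a, b, c, y)).1) (connEvent (row 15 n (a, b, c, y)).2.1)
        (connEvent (row 15 n (a, b, c, y)).2.2))
    (H22ac : ∀ (n : ℕ) (w : Sym2 (Fin n) → unitInterval) (a b c y h : Fin n) (side : Fin n → Bool),
      side a = true → side c = true → side b = false → side y = false →
      (∀ u v : Fin n, u ≠ h → v ≠ h → side u ≠ side v → w s(u, v) = 0) →
      0 ≤ sahiE3 (prodBernoulli w) (connEvent (row 15 n (a, b, c, y)).1) (connEvent (row 15 n (a, b, c, y)).2.1)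
        (connEvent (row 15 n (a, b, c, y)).2.2))
    (H22ay : ∀ (n : ℕ) (w : Sym2 (Fin n) → unitInterval) (a b c y h : Fin n) (side : Fin n → Bool),
      side a = true → side y = true → side b = false → side c = false →
      (∀ u v : Fin n, u ≠ h → v ≠ h → side u ≠ side v → w s(u, v) = 0) →
      0 ≤ sahiE3 (prodBernoulli w) (connEvent (row 15 n (a, b, c, y)).1) (connEvent (row 15 n (a, b, c, y)).2.1)
        (connEvent (row 15 n (a, b, c, y)).2.2))
    (H : ∀ (n : ℕ) (w : Sym2 (Fin n) → unitInterval) (a b c y : Fin n),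
      (∀ (h : Fin n) (side : Fin n → Bool), (∀ u v : Fin n, u ≠ h → v ≠ h → side u ≠ side v → w s(u, v) = 0) →
        (∃ u v : Fin n, u ≠ h ∧ side u = true ∧ 0 < (w s(u, v) : ℝ)) →
        (∃ u v : Fin n, u ≠ h ∧ side u = false ∧ 0 < (w s(u, v) : ℝ)) → False) →
      0 ≤ sahiE3 (prodBernoulli w) (connEvent (row 15 n (a, b, c, y)).1) (connEvent (row 15 n (a, b, c, y)).2.1)
        (connEvent (row 15 n (a, b, c, y)).2.2))
    (n : ℕ) (w : Sym2 (Fin n) → unitInterval) (a b c y : Fin n) :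
    0 ≤ sahiE3 (prodBernoulli w) (connEvent (row 15 n (a, b, c, y)).1) (connEvent (row 15 n (a, b, c, y)).2.1)
      (connEvent (row 15 n (a, b, c, y)).2.2) := by
  classical
  -- induction on the number of positive-weight edges
  suffices main : ∀ (m : ℕ) (w : Sym2 (Fin n) → unitInterval) (a b c y : Fin n),
      (Finset.univ.filter (fun e : Sym2 (Fin n) => 0 < (w e : ℝ))).card ≤ m →
      0 ≤ sahiE3 (prodBernoulli w) (connEvent (row 15 n (a, b, c, y)).1) (connEvent (row 15 n (a, b, c, y)).2.1)
        (connEvent (row 15 n (a, b, c, y)).2.2) from main _ w a b c y le_rfl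
  intro m
  induction m with
  | zero =>
    intro w a b c y hm
    -- no positive edge: no cut colouring exists
    refine H n w a b c y fun h side _ h1 _ => ?_
    obtain ⟨u, v, _, _, huv⟩ := h1
    have : s(u, v) ∈ Finset.univ.filter (fun e : Sym2 (Fin n) => 0 < (w e : ℝ)) := Finset.mem_filter.2 ⟨Finset.mem_univ _, huv⟩
    rw [Nat.le_zero, Finset.card_eq_zero] at hm
    rw [hm] at this; exact absurd this (Finset.notMem_empty _)
  | succ m ih =>
    intro w a b c y hm
    by_cases hcut : ∃ (h : Fin n) (side : Fin n → Bool), (∀ u v : Fin n, u ≠ h → v ≠ h → side u ≠ side v → w s(u, v) = 0) ∧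
        (∃ u v : Fin n, u ≠ h ∧ side u = true ∧ 0 < (w s(u, v) : ℝ)) ∧
        (∃ u v : Fin n, u ≠ h ∧ side u = false ∧ 0 < (w s(u, v) : ℝ))
    swap
    · exact H n w a b c y fun h side hw h1 h2 => hcut ⟨h, side, hw, h1, h2⟩
    obtain ⟨h, side₀, hw₀, hpos₀, hneg₀⟩ := hcut
    -- the restriction step: delete everything outside the `true` side of a colouring `sd`
    have restrict : ∀ (sd : Fin n → Bool), (∀ u v : Fin n, u ≠ h → v ≠ h → sd u ≠ sd v → w s(u, v) = 0) →
        (∃ u v : Fin n, u ≠ h ∧ sd u = false ∧ 0 < (w s(u, v) : ℝ)) →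
        ∀ a' b' c' y' : Fin n, (∀ x ∈ [a', b', c', y'], sd x = true ∨ x = h) →
        0 ≤ sahiE3 (prodBernoulli w) (connEvent (row 15 n (a', b', c', y')).1) (connEvent (row 15 n (a', b', c', y')).2.1)
          (connEvent (row 15 n (a', b', c', y')).2.2) := by
      intro sd hsd hfalse a' b' c' y' hpts
      have hrow : row 15 n (a', b', c', y') = (sep [a', b'] [c'], sep [a', c'] [y'], sep [b'] [y']) := rfl
      rw [hrow]
      have hpts' : ∀ x ∈ [a', b'] ++ [c'] ++ [a', c'] ++ [y'] ++ [b'] ++ [y'], sd x = true ∨ x = h := by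
        intro x hx
        apply hpts x
        simp only [List.mem_append, List.mem_cons, List.mem_nil_iff, or_false] at hx ⊢
        tauto
      rw [sahiE3_sep_restrictSide w h sd hsd [a', b'] [c'] [a', c'] [y'] [b'] [y'] hpts']
      set F₁ : Finset (Sym2 (Fin n)) := Finset.univ.filter (fun e : Sym2 (Fin n) => ∀ u ∈ e, sd u = true ∨ u = h) with hF₁
      set w' : Sym2 (Fin n) → unitInterval := fun e => if e ∈ (↑F₁ : Set (Sym2 (Fin n))) then w e else 0 with hw'
      apply ih w' a' b' c' y'
      -- the positive edges of `w'` form a proper subset of those of `w`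
      obtain ⟨u, v, huh, hsu, huv⟩ := hfalse
      have hsub : Finset.univ.filter (fun e : Sym2 (Fin n) => 0 < (w' e : ℝ)) ⊂
          Finset.univ.filter (fun e : Sym2 (Fin n) => 0 < (w e : ℝ)) := by
        rw [Finset.ssubset_iff_subset_ne]
        refine ⟨fun e he => ?_, fun heq => ?_⟩
        · rw [Finset.mem_filter] at he ⊢
          refine ⟨Finset.mem_univ _, ?_⟩
          have := he.2
          simp only [hw'] at this
          split_ifs at this with hmem
          · exact this
          · simp at this
        · have hin : s(u, v) ∈ Finset.univ.filter (fun e : Sym2 (Fin n) => 0 < (w e : ℝ)) :=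
            Finset.mem_filter.2 ⟨Finset.mem_univ _, huv⟩
          rw [← heq, Finset.mem_filter] at hin
          have hnot : s(u, v) ∉ F₁ := by
            rw [hF₁, Finset.mem_filter]
            intro hmem
            rcases hmem.2 u (Sym2.mem_iff.2 (Or.inl rfl)) with h1 | h1
            · rw [hsu] at h1; exact Bool.false_ne_true h1
            · exact huh h1
          have : (w' s(u, v) : ℝ) = 0 := by
            simp only [hw', Finset.mem_coe]
            rw [if_neg hnot]; rfl
          linarith [hin.2]
      have := Finset.card_lt_card hsub
      omega
    -- colour flips keep the hypotheses
    have flip : ∀ (sd : Fin n → Bool), (∀ u v : Fin n, u ≠ h → v ≠ h → sd u ≠ sd v → w s(u, v) = 0) →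
        ∀ u v : Fin n, u ≠ h → v ≠ h → (fun x => !sd x) u ≠ (fun x => !sd x) v → w s(u, v) = 0 :=
      fun sd hsd u v hu hv hne => hsd u v hu hv (fun e => hne (by simp only [e]))
    have hw₁ := flip side₀ hw₀
    have hneg₁ : ∃ u v : Fin n, u ≠ h ∧ (fun x => !side₀ x) u = false ∧ 0 < (w s(u, v) : ℝ) := by
      obtain ⟨u, v, hu, hs, hp⟩ := hpos₀; exact ⟨u, v, hu, by simp [hs], hp⟩
    have hpos₁ : ∃ u v : Fin n, u ≠ h ∧ (fun x => !side₀ x) u = true ∧ 0 < (w s(u, v) : ℝ) := by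
      obtain ⟨u, v, hu, hs, hp⟩ := hneg₀; exact ⟨u, v, hu, by simp [hs], hp⟩
    -- recolouring `h` keeps the hypotheses
    have recol : ∀ (sd : Fin n → Bool) (X : Bool), (∀ u v : Fin n, u ≠ h → v ≠ h → sd u ≠ sd v → w s(u, v) = 0) →
        ∀ u v : Fin n, u ≠ h → v ≠ h → Function.update sd h X u ≠ Function.update sd h X v → w s(u, v) = 0 :=
      fun sd X hsd u v hu hv hne => hsd u v hu hv (by rwa [Function.update_of_ne hu, Function.update_of_ne hv] at hne)
    have recol_false : ∀ (sd : Fin n → Bool) (X : Bool), (∃ u v : Fin n, u ≠ h ∧ sd u = false ∧ 0 < (w s(u, v) : ℝ)) →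
        ∃ u v : Fin n, u ≠ h ∧ Function.update sd h X u = false ∧ 0 < (w s(u, v) : ℝ) :=
      fun sd X ⟨u, v, hu, hs, hp⟩ => ⟨u, v, hu, by rw [Function.update_of_ne hu]; exact hs, hp⟩
    -- a terminal equal to `h` can be given any colour: helper producing "true or = h" lists
    have mk4 : ∀ (sd : Fin n → Bool) (p q r s : Fin n),
        (sd p = true ∨ p = h) → (sd q = true ∨ q = h) → (sd r = true ∨ r = h) → (sd s = true ∨ s = h) →
        ∀ x ∈ [p, q, r, s], sd x = true ∨ x = h := by
      intro sd p q r s hp hq hr hs x hx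
      simp only [List.mem_cons, List.mem_nil_iff, or_false] at hx
      rcases hx with rfl | rfl | rfl | rfl <;> assumption
    -- case analysis on the colours of the four terminals (under `side₀`)
    rcases ha : side₀ a with _ | _ <;> rcases hb : side₀ b with _ | _ <;> rcases hc : side₀ c with _ | _ <;>
      rcases hy : side₀ y with _ | _
    · -- FFFF: delete the `true` side (use the flipped colouring)
      exact restrict _ hw₁ hneg₁ a b c y (mk4 _ a b c y (Or.inl (by simp [ha])) (Or.inl (by simp [hb]))
        (Or.inl (by simp [hc])) (Or.inl (by simp [hy])))
    · -- FFFT: lone `y` true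
      by_cases hyh : y = h
      · exact restrict _ hw₁ hneg₁ a b c y (mk4 _ a b c y (Or.inl (by simp [ha])) (Or.inl (by simp [hb]))
          (Or.inl (by simp [hc])) (Or.inr hyh))
      · refine sahiE3_row15_nonneg_of_threeOneCut_y w a b c y h (fun x => !side₀ x) (by simp [ha]) (by simp [hb]) (by simp [hc])
          (by simp [hy]) hw₁ ?_
        exact restrict _ hw₁ hneg₁ a b c h (mk4 _ a b c h (Or.inl (by simp [ha])) (Or.inl (by simp [hb]))
          (Or.inl (by simp [hc])) (Or.inr rfl))
    · -- FFTF: lone `c` true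
      by_cases hch : c = h
      · exact restrict _ hw₁ hneg₁ a b c y (mk4 _ a b c y (Or.inl (by simp [ha])) (Or.inl (by simp [hb])) (Or.inr hch)
          (Or.inl (by simp [hy])))
      · refine sahiE3_row15_nonneg_of_threeOneCut_c w a b c y h (fun x => !side₀ x) (by simp [ha]) (by simp [hb]) (by simp [hy])
          (by simp [hc]) hw₁ ?_
        exact restrict _ hw₁ hneg₁ a b h y (mk4 _ a b h y (Or.inl (by simp [ha])) (Or.inl (by simp [hb])) (Or.inr rfl)
          (Or.inl (by simp [hy])))
    · -- FFTT: {a,b} false | {c,y} true: the `AB` theorem with the flipped colouring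
      exact H22ab n w a b c y h (fun x => !side₀ x) (by simp [ha]) (by simp [hb]) (by simp [hc]) (by simp [hy]) hw₁
    · -- FTFF: lone `b` true
      by_cases hbh : b = h
      · exact restrict _ hw₁ hneg₁ a b c y (mk4 _ a b c y (Or.inl (by simp [ha])) (Or.inr hbh) (Or.inl (by simp [hc]))
          (Or.inl (by simp [hy])))
      · refine sahiE3_row15_nonneg_of_threeOneCut_b w a b c y h (fun x => !side₀ x) (by simp [ha]) (by simp [hc]) (by simp [hy])
          (by simp [hb]) hw₁ ?_
        exact restrict _ hw₁ hneg₁ a h c y (mk4 _ a h c y (Or.inl (by simp [ha])) (Or.inr rfl) (Or.inl (by simp [hc]))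
          (Or.inl (by simp [hy])))
    · -- FTFT: {a,c} false | {b,y} true: hypothesis with the flipped colouring
      exact H22ac n w a b c y h (fun x => !side₀ x) (by simp [ha]) (by simp [hc]) (by simp [hb]) (by simp [hy]) hw₁
    · -- FTTF: {a,y} false | {b,c} true: the `AY` theorem with the flipped colouring
      exact H22ay n w a b c y h (fun x => !side₀ x) (by simp [ha]) (by simp [hy]) (by simp [hb]) (by simp [hc]) hw₁
    · -- FTTT: lone `a` false
      by_cases hah : a = h
      · exact restrict _ hw₀ hneg₀ a b c y (mk4 _ a b c y (Or.inr hah) (Or.inl hb) (Or.inl hc) (Or.inl hy))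
      · refine sahiE3_row15_nonneg_of_threeOneCut_a w a b c y h side₀ hb hc hy ha hw₀ ?_
        exact restrict _ hw₀ hneg₀ h b c y (mk4 _ h b c y (Or.inr rfl) (Or.inl hb) (Or.inl hc) (Or.inl hy))
    · -- TFFF: lone `a` true
      by_cases hah : a = h
      · exact restrict _ hw₁ hneg₁ a b c y (mk4 _ a b c y (Or.inr hah) (Or.inl (by simp [hb])) (Or.inl (by simp [hc]))
          (Or.inl (by simp [hy])))
      · refine sahiE3_row15_nonneg_of_threeOneCut_a w a b c y h (fun x => !side₀ x) (by simp [hb]) (by simp [hc]) (by simp [hy])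
          (by simp [ha]) hw₁ ?_
        exact restrict _ hw₁ hneg₁ h b c y (mk4 _ h b c y (Or.inr rfl) (Or.inl (by simp [hb])) (Or.inl (by simp [hc]))
          (Or.inl (by simp [hy])))
    · -- TFFT: {a,y} true | {b,c} false: the `AY` theorem
      exact H22ay n w a b c y h side₀ ha hy hb hc hw₀
    · -- TFTF: {a,c} true | {b,y} false: hypothesis
      exact H22ac n w a b c y h side₀ ha hc hb hy hw₀
    · -- TFTT: lone `b` false
      by_cases hbh : b = h
      · exact restrict _ hw₀ hneg₀ a b c y (mk4 _ a b c y (Or.inl ha) (Or.inr hbh) (Or.inl hc) (Or.inl hy))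
      · refine sahiE3_row15_nonneg_of_threeOneCut_b w a b c y h side₀ ha hc hy hb hw₀ ?_
        exact restrict _ hw₀ hneg₀ a h c y (mk4 _ a h c y (Or.inl ha) (Or.inr rfl) (Or.inl hc) (Or.inl hy))
    · -- TTFF: the `AB` theorem
      exact H22ab n w a b c y h side₀ ha hb hc hy hw₀
    · -- TTFT: lone `c` false
      by_cases hch : c = h
      · exact restrict _ hw₀ hneg₀ a b c y (mk4 _ a b c y (Or.inl ha) (Or.inl hb) (Or.inr hch) (Or.inl hy))
      · refine sahiE3_row15_nonneg_of_threeOneCut_c w a b c y h side₀ ha hb hy hc hw₀ ?_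
        exact restrict _ hw₀ hneg₀ a b h y (mk4 _ a b h y (Or.inl ha) (Or.inl hb) (Or.inr rfl) (Or.inl hy))
    · -- TTTF: lone `y` false
      by_cases hyh : y = h
      · exact restrict _ hw₀ hneg₀ a b c y (mk4 _ a b c y (Or.inl ha) (Or.inl hb) (Or.inl hc) (Or.inr hyh))
      · refine sahiE3_row15_nonneg_of_threeOneCut_y w a b c y h side₀ ha hb hc hy hw₀ ?_
        exact restrict _ hw₀ hneg₀ a b c h (mk4 _ a b c h (Or.inl ha) (Or.inl hb) (Or.inl hc) (Or.inr rfl))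
    · -- TTTT: delete the `false` side
      exact restrict _ hw₀ hneg₀ a b c y (mk4 _ a b c y (Or.inl ha) (Or.inl hb) (Or.inl hc) (Or.inl hy))

end Summit.CriticalPhenomena.PercolationContinuityZ3.Theorems.FrontierDecRows
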